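import Mathlib
import Summits.Ventures.PercRepro.TriangleCapFourBand

/-!
# PercRepro — THE MAX-DEGREE LEMMA AT EVERY LEVEL (p3, gen 40; part 158)

`deg_add_le_card_of_dense (a) (ha : 3 ≤ a) (hk : 2a ≤ k) (hm : (a − 1)(k − a + 1) < m) : ∀ x, d(x) + a ≤ k` —
a `K₄⁻`-free graph with more edges than `K_{a−1, k−a+1}` has every degree `≤ k − a`. Level `3` is the
count of part 154 with at most one non-neighbour (`deg_add_three_le_card_of_dense`: `2m ≤ 3(k−1)` or
`2m ≤ 4(k−2)`); level `a + 1` follows from level `a` by deleting a non-neighbour `y` of a vertex `x` of degree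
`k − a`: `D − y` has `m − d(y) ≥ m − (k − a) > (a − 1)(k − a)` edges on `k − 1` vertices, so `x` has degree
`≤ (k − 1) − a` there — but `y ≁ x` keeps the degree of `x`. Axioms: standard.
-/

namespace PercRepro

namespace TriangleCap

namespace C047

open Finset

universe u

variable {V : Type*} [Fintype V] [DecidableEq V]

/-- **LEVEL `3`:** `K₄⁻`-free, `k ≥ 4`, `m ≥ 2k − 3` ⇒ every degree is `≤ k − 3`. -/
theorem deg_add_three_le_card_of_dense (D : SimpleGraph V) [DecidableRel D.Adj] (hK : K4mFree D)
    (hk : 4 ≤ Fintype.card V) (hm : 2 * Fintype.card V ≤ D.edgeFinset.card + 3) (x : V) :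
    deg D x + 3 ≤ Fintype.card V := by
  by_contra hcon
  push Not at hcon
  obtain ⟨N, hN⟩ : ∃ N : Finset V, N = univ.filter (fun v => D.Adj x v) := ⟨_, rfl⟩
  have hdx : deg D x = N.card := by rw [hN]; rfl
  have hmemN : ∀ v, v ∈ N ↔ D.Adj x v := fun v => by rw [hN, mem_filter]; simp only [mem_univ, true_and]
  have hxN : x ∉ N := fun h => D.irrefl ((hmemN x).mp h)
  have hScard : (insert x N).card = N.card + 1 := card_insert_of_notMem hxN
  have hSc : ((insert x N)ᶜ).card + N.card + 1 = Fintype.card V := by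
    rw [card_compl, hScard]
    have := card_le_univ (insert x N)
    omega
  have hid := two_mul_card_edges_eq_adjPairs_add D (insert x N)
  have hadjS : adjPairs D (insert x N) = 2 * N.card + adjPairs D N := by
    rw [adjPairs_eq_sum_degIn, sum_insert hxN, adjPairs_eq_sum_degIn]
    have hx : degIn D (insert x N) x = N.card := by
      unfold degIn
      congr 1
      ext v
      rw [mem_filter, mem_insert, hmemN]
      constructor
      · rintro ⟨-, h⟩; exact h
      · intro h; exact ⟨Or.inr h, h⟩
    have hu : ∀ u ∈ N, degIn D (insert x N) u = degIn D N u + 1 := by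
      intro u hu
      unfold degIn
      rw [filter_insert, if_pos (D.adj_symm ((hmemN u).mp hu)), card_insert_of_notMem]
      intro h
      rw [mem_filter] at h
      exact hxN h.1
    rw [hx, sum_congr rfl hu, sum_add_distrib, sum_const, smul_eq_mul, mul_one]
    ring
  have hdegS : ∀ y ∈ (insert x N)ᶜ, degIn D (insert x N) y = degIn D N y := by
    intro y hy
    rw [mem_compl, mem_insert, not_or] at hy
    unfold degIn
    rw [filter_insert, if_neg]
    intro h
    exact hy.2 ((hmemN y).mpr (D.adj_symm h))
  have hout : ∑ y ∈ (insert x N)ᶜ, degIn D (insert x N) y = ∑ y ∈ (insert x N)ᶜ, degIn D N y :=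
    sum_congr rfl hdegS
  rw [hadjS, hout] at hid
  have hnotadj : ∀ y ∈ (insert x N)ᶜ, y ≠ x := by
    intro y hy
    rw [mem_compl, mem_insert, not_or] at hy
    exact hy.1
  have hpair : ∀ y ∈ (insert x N)ᶜ, 2 * degIn D N y + adjPairs D N ≤ 2 * N.card := by
    intro y hy
    have := two_mul_degIn_add_adjPairs_le D hK (hnotadj y hy)
    rwa [← hN] at this
  have hadjN : adjPairs D N ≤ N.card := by
    have := adjPairs_nbhd_le D hK x
    rwa [← hN] at this
  have hRcard : ((insert x N)ᶜ).card ≤ 1 := by omega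
  rcases (show ((insert x N)ᶜ).card = 0 ∨ ((insert x N)ᶜ).card = 1 by omega) with h0 | h1
  · rw [card_eq_zero] at h0
    rw [h0, sum_empty, sum_empty] at hid
    omega
  · obtain ⟨y, hy⟩ := card_eq_one.mp h1
    have hyR : y ∈ (insert x N)ᶜ := by rw [hy]; exact mem_singleton_self y
    have hp := hpair y hyR
    rw [hy, sum_singleton, sum_singleton] at hid
    have hin : degIn D ({y} : Finset V) y = 0 := by
      unfold degIn
      rw [card_eq_zero, filter_eq_empty_iff]
      intro v hv
      rw [mem_singleton] at hv
      rw [hv]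
      exact D.irrefl
    rw [hin] at hid
    omega

/-- **EVERY LEVEL, BY INDUCTION ON `a`:** `K₄⁻`-free, `2a ≤ k`, `(a − 1)(k − a + 1) < m` ⇒ every degree is
`≤ k − a`. -/
theorem deg_add_le_card_of_dense_aux (a : ℕ) (ha : 3 ≤ a) :
    ∀ (W : Type u) [Fintype W] [DecidableEq W] (D : SimpleGraph W) [DecidableRel D.Adj], K4mFree D →
      2 * a ≤ Fintype.card W → (a - 1) * (Fintype.card W - a + 1) < D.edgeFinset.card →
      ∀ x, deg D x + a ≤ Fintype.card W := by
  induction a, ha using Nat.le_induction with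
  | base =>
    intro W _ _ D _ hK hk hm x
    have e : (3 - 1) * (Fintype.card W - 3 + 1) = 2 * (Fintype.card W - 2) := by omega
    rw [e] at hm
    exact deg_add_three_le_card_of_dense D hK (by omega) (by omega) x
  | succ a ha ih =>
    intro W _ _ D _ hK hk hm x
    -- level `a` on `D`
    have hm' : (a - 1) * (Fintype.card W - a + 1) < D.edgeFinset.card := by
      have e1 : (a + 1 - 1) * (Fintype.card W - (a + 1) + 1) = a * (Fintype.card W - a) := by
        rw [show a + 1 - 1 = a from by omega, show Fintype.card W - (a + 1) + 1 = Fintype.card W - a from by omega]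
      rw [e1] at hm
      have : (a - 1) * (Fintype.card W - a + 1) ≤ a * (Fintype.card W - a) := by
        obtain ⟨a', rfl⟩ : ∃ a', a = a' + 1 := ⟨a - 1, by omega⟩
        obtain ⟨c, hc⟩ : ∃ c, Fintype.card W = a' + 1 + c := ⟨Fintype.card W - (a' + 1), by omega⟩
        rw [hc]
        have e2 : a' + 1 - 1 = a' := by omega
        have e3 : a' + 1 + c - (a' + 1) + 1 = c + 1 := by omega
        have e4 : a' + 1 + c - (a' + 1) = c := by omega
        rw [e2, e3, e4]
        nlinarith
      omega
    have hlev := ih W D hK (by omega) hm'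
    by_contra hcon
    push Not at hcon
    have hdx : deg D x + a = Fintype.card W := by have := hlev x; omega
    -- a non-neighbour `y ≠ x` of `x` exists: `|N(x)| + 1 < k`
    have hN : (univ.filter (fun v => D.Adj x v)).card + 1 < Fintype.card W := by
      have : deg D x = (univ.filter (fun v => D.Adj x v)).card := rfl
      omega
    have hex : ∃ y, y ≠ x ∧ ¬ D.Adj x y := by
      by_contra hall
      push Not at hall
      have hsub : univ.erase x ⊆ univ.filter (fun v => D.Adj x v) := by
        intro y hy
        rw [mem_erase] at hy
        exact mem_filter.mpr ⟨mem_univ y, hall y hy.1⟩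
      have := card_le_card hsub
      rw [card_erase_of_mem (mem_univ x), card_univ] at this
      omega
    obtain ⟨y, hyx, hxy⟩ := hex
    -- `D − y`: level `a` at `k − 1`
    have hK' := k4mFree_del D hK y
    have hcard := card_del y
    have hedges := card_edges_del D y
    have hdy := hlev y
    have hm'' : (a - 1) * (Fintype.card {v : W // v ≠ y} - a + 1) < (del D y).edgeFinset.card := by
      have e1 : (a + 1 - 1) * (Fintype.card W - (a + 1) + 1) = a * (Fintype.card W - a) := by
        rw [show a + 1 - 1 = a from by omega, show Fintype.card W - (a + 1) + 1 = Fintype.card W - a from by omega]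
      rw [e1] at hm
      have e2 : Fintype.card {v : W // v ≠ y} - a + 1 = Fintype.card W - a := by omega
      rw [e2]
      obtain ⟨a', rfl⟩ : ∃ a', a = a' + 1 := ⟨a - 1, by omega⟩
      obtain ⟨c, hc⟩ : ∃ c, Fintype.card W = a' + 1 + c := ⟨Fintype.card W - (a' + 1), by omega⟩
      rw [hc] at hm hdy hdx ⊢
      have e3 : a' + 1 + c - (a' + 1) = c := by omega
      have e4 : a' + 1 - 1 = a' := by omega
      rw [e3] at hm ⊢
      rw [e4]
      nlinarith
    have hx' := ih {v : W // v ≠ y} (del D y) hK' (by omega) hm'' ⟨x, hyx.symm⟩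
    have hdel := deg_del D y ⟨x, hyx.symm⟩
    simp only [hxy, if_false, add_zero] at hdel
    omega

/-- **THE MAX-DEGREE LEMMA AT LEVEL `a`:** `K₄⁻`-free, `3 ≤ a`, `2a ≤ k`, `(a − 1)(k − a + 1) < m` ⇒ every
degree is `≤ k − a`. -/
theorem deg_add_le_card_of_dense (D : SimpleGraph V) [DecidableRel D.Adj] (hK : K4mFree D) (a : ℕ)
    (ha : 3 ≤ a) (hk : 2 * a ≤ Fintype.card V) (hm : (a - 1) * (Fintype.card V - a + 1) < D.edgeFinset.card)
    (x : V) : deg D x + a ≤ Fintype.card V :=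
  deg_add_le_card_of_dense_aux a ha V D hK hk hm x

end C047

end TriangleCap

end PercRepro
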